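import Summits.QuantumFields.YangMills.Theorems.UnitScaleTiltProp7HolRatioPerStep
import Literature.MathematicalPhysics.QuantumFieldTheory.Balaban1983to89.B10Eq27TorusAxialLog
import HarnessLib

/-!
# Route `UnitScaleTilt`, crux K1 «MinimiserStabilityRegPr» (stmt-QuantumFields-19200), route-R E′ (A′)-on-Σ, P-A2-COMB (β), item «R0-RECURSION» (★★OWNER RULINGS №19∕№20; px13 g6's pen),
# sub-brick R0-LIN-S FILE 3 — THE STAIR-RATIO DERIVATIVE IS THE TRANSPORTED SUM OF THE LINK DERIVATIVES:
# `D[ W(Γ)·W₀(Γ)⁻¹ ](a) v = Y_{V₀}(Γ)`, `Y b := W′_b v · V₀(b)*` — lit `covWalkSum` ((58) of [Balaban1985Averaging] read to first order), for ANY differentiable units-valued family through a unitary background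

Cell `ym3-torus`, twin-width seat `ym-routeR-w2` (gen 9); px13 g6 06:03:03Z «R0-LIN-S FILE 3 — GO∕NO»: GO.  THEOREMS ONLY (0 `def`, 0 `sorry`); `--supports stmt-QuantumFields-19200 --as helper`,
count-neutral.  YM₃ on T³ is a ladder rung (R3), not the Clay problem; nothing here claims the stub, the crux, (β), `hPA2`, `hcoS`, d = 4 or the mass gap.

THE POINT.  px13 g6's F-β (`Prop7StairRem2Row`, ★px17 ✓`Prop7TwistedTowerFramesT3.stair_row_of_twoBlockSup`'s letters) bounds the second-order remainder of the PLAIN-tower stair ratio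
`W(Γ)·V₀(Γ)*` against the ABSTRACT linear part `covWalkSum V₀ ℓY Γ` (lit ✓`BlockAveragingEMLLinearisedBackground.covWalkSum`: each link term transported back to the start of the walk by
the background holonomy, (58)); F-γ must identify that abstract linear part with THE Fréchet derivative so that ✓R0-LIN-S `Prop7SymFrameLinearResponseStep.fderiv_coe_frameAccU_succ_apply`
lifts it to `fderiv (frameAccU (k+1))` and the top lands on R0-DOOR's `hrs`.  This file proves the identity for an ARBITRARY family `W : E → GaugeField P k (Matrix n n ℂ)ˣ` of
units-valued fields, ℂ-differentiable bondwise at `a` with derivatives `W′ b`, passing at `a` through a special-unitary background `V₀` (`↑(W a b) = ↑(V₀ b)` — the units-valued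
plain tower `emlIterU k (e^{A}·U₀♭)` at `A = 0` is the case in point; an `SU(N)`-TYPED family cannot be ℂ-differentiated non-trivially, so the units-valued reading is the right one, and
at real directions its values are the `SU(N)` tower's, ✓`Prop7TwistedTowerFramesT3.emlIterU_eq_unitsField_iter`∕`coe_holT_mul_inv_eq`):
* §1 (✓`Prop7HolRatioPerStep.coe_mul_star_self`∕`coe_star_mul_self` by name) `coe_units_inv_eq_star` (a unit whose value is special-unitary has inverse `star`), ★ `hasFDerivAt_coe_units_inv` (derivative of `↑(u ·)⁻¹` at a general
  base point: `−u(a)⁻¹·u′·u(a)⁻¹`, Mathlib `hasFDerivAt_ringInverse`).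
* §2 `coe_holT_eq_coe_holAt` ∕ `coe_holT_inv_eq_star_holAt` — at the base point the units holonomy `holT (W a) x w` IS `holAt V₀ (walk x w)` and its inverse is the conjugate transpose.
* §3 ★★ `exists_hasFDerivAt_holT_mul_star_holAt` — `A ↦ ↑(holT (W A) x w) · (↑(holAt V₀ (walk x w)))*` has a derivative `D` at `a` with `D v = covWalkSum V₀ (b ↦ W′ b v · (↑(V₀ b))*) (walk x w)`
  (induction along the walk: forward step = product rule, backward step = §1's inverse rule + `V₀(b)*·V₀(b) = 1`, transport = `covWalkSum_cons`); `differentiableAt_holT_mul_star_holAt`;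
  ★★★ `fderiv_holT_mul_star_holAt_apply` — `fderiv ℂ (A ↦ ↑(holT (W A) x w)·(↑(holAt V₀ (walk x w)))*) a v = covWalkSum V₀ (b ↦ fderiv ℂ (A ↦ ↑(W A b)) a v · (↑(V₀ b))*) (walk x w)`;
  ★★★ `fderiv_holT_ratio_apply` — the same for the UNITS ratio `↑(holT (W A) x w · (holT (W a) x w)⁻¹)` = ✓R0-LIN-S's stair-ratio letter `R_{k,i}` (`x := emb y`, `w := stairWord i.2.1 (off i.1)`,
  `W t := emlIterU k (W̃ t)`), so `ℓR y i := fderiv … a A = covWalkSum V₀ ℓY (walk (emb y) st_i)` with `ℓY b := fderiv ℂ (A ↦ ↑(W A b)) a A · (↑(V₀ b))*` — F-β's `ℓY`∕`covWalkSum V₀ ℓY Γ`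
  letters TOKEN FOR TOKEN.
* §4 `fderiv_link_pertVar_apply` — the link letter: `fderiv ℂ (A ↦ ↑(W A b)·(↑(V₀ b))* − 1) a v = fderiv ℂ (A ↦ ↑(W A b)) a v · (↑(V₀ b))*` (`pertVar`'s shape, ✓`Prop7TwistedTowerFramesT3.coe_unitsField_mul_inv_sub_one`).
HONEST SCOPE.  Kinematics (calculus of finite products); no estimate, no smallness, no currency; nothing of print asserted beyond (58)'s bookkeeping; (R0), REM2ˢ, (β), `hD`, `hPA2`,
`hcoS`, the stub and the crux are NOT advanced analytically by this file.

References: T. Bałaban, CMP 98 (1985) 17–51 [Balaban1985Averaging] ((8)–(9) p.18, (56)–(58) p.27, (82) p.30); CMP 102 (1985) 277–309 [Balaban1985Variational] ((15) p.280).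
-/

set_option autoImplicit false

noncomputable section

open scoped Matrix.Norms.L2Operator BigOperators

namespace Summit.QuantumFields.YangMills.Theorems.Prop7HolRatioLinearResponse

open NormedSpace
open Literature.MathematicalPhysics.QuantumFieldTheory.Balaban1983to89
open T4Continuum BlockAveraging
open B10Eq27TorusAxialLog (holT holT_nil holT_cons_true holT_cons_false)
open BlockAveragingEMLLinearised (stepFactor)
open BlockAveragingEMLLinearisedBackground (covStep covWalkSum covWalkSum_nil covWalkSum_cons)
open Summit.QuantumFields.YangMills.Theorems.Prop7HolRatioPerStep (coe_star_mul_self coe_mul_star_self)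

variable {n : Type*} [Fintype n] [DecidableEq n] [Nonempty n] {P : Params} {k : ℕ}
variable {E : Type*} [NormedAddCommGroup E] [NormedSpace ℂ E]

/-! ## §1 Special-unitary bookkeeping and the derivative of a units inverse -/

omit [Nonempty n] in
/-- A unit of `M_n(ℂ)` whose value is special-unitary has inverse the conjugate transpose. [folklore] -/
theorem coe_units_inv_eq_star {u : (Matrix n n ℂ)ˣ} {g : Matrix.specialUnitaryGroup n ℂ} (h : (u : Matrix n n ℂ) = (g : Matrix n n ℂ)) :
    ((u⁻¹ : (Matrix n n ℂ)ˣ) : Matrix n n ℂ) = star (g : Matrix n n ℂ) := by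
  have h1 : (u : Matrix n n ℂ) * star (g : Matrix n n ℂ) = 1 := by rw [h, coe_mul_star_self]
  calc ((u⁻¹ : (Matrix n n ℂ)ˣ) : Matrix n n ℂ) = ((u⁻¹ : (Matrix n n ℂ)ˣ) : Matrix n n ℂ) * ((u : Matrix n n ℂ) * star (g : Matrix n n ℂ)) := by rw [h1, mul_one]
    _ = star (g : Matrix n n ℂ) := by rw [← mul_assoc, Units.inv_mul, one_mul]

section Calculus

variable {𝕜 : Type*} [NontriviallyNormedField 𝕜] {F : Type*} [NormedAddCommGroup F] [NormedSpace 𝕜 F]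
  {𝔸 : Type*} [NormedRing 𝔸] [NormedAlgebra 𝕜 𝔸] [CompleteSpace 𝔸]

/-- ★ **THE DERIVATIVE OF A UNITS INVERSE AT A GENERAL BASE POINT**: `D[↑(u ·)⁻¹](a) = −u(a)⁻¹ · u′ · u(a)⁻¹` (Mathlib `hasFDerivAt_ringInverse` ∘ chain rule).  [folklore] -/
theorem hasFDerivAt_coe_units_inv {u : F → 𝔸ˣ} {u' : F →L[𝕜] 𝔸} {a : F} (hu : HasFDerivAt (fun x => (u x : 𝔸)) u' a) :
    HasFDerivAt (fun x => (((u x)⁻¹ : 𝔸ˣ) : 𝔸)) (-(ContinuousLinearMap.mulLeftRight 𝕜 𝔸 ((u a)⁻¹ : 𝔸ˣ) ((u a)⁻¹ : 𝔸ˣ)).comp u') a := by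
  have hinv : HasFDerivAt (Ring.inverse : 𝔸 → 𝔸)
      (-ContinuousLinearMap.mulLeftRight 𝕜 𝔸 ((u a)⁻¹ : 𝔸ˣ) ((u a)⁻¹ : 𝔸ˣ)) (u a : 𝔸) :=
    hasFDerivAt_ringInverse (u a)
  have heq : (fun x => (((u x)⁻¹ : 𝔸ˣ) : 𝔸)) = Ring.inverse ∘ fun x => (u x : 𝔸) := by
    funext x; simp [Function.comp]
  rw [heq]
  refine (hinv.comp a hu).congr_fderiv ?_
  ext v
  simp

end Calculus

/-! ## §2 At the base point the units holonomy is the special-unitary holonomy -/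

variable (V₀ : GaugeField P k (Matrix.specialUnitaryGroup n ℂ)) (W : E → GaugeField P k (Matrix n n ℂ)ˣ) {a : E}

omit [NormedAddCommGroup E] [NormedSpace ℂ E] in
/-- `↑(holT (W a) x w) = ↑(holAt V₀ (walk x w))` when `↑(W a b) = ↑(V₀ b)` bondwise (both are the ordered product of the step factors). [cite: Balaban1985Averaging, (9) p.18] -/
theorem coe_holT_eq_coe_holAt (hWa : ∀ b : PBond P k, ((W a b : (Matrix n n ℂ)ˣ) : Matrix n n ℂ) = ((V₀ b : Matrix.specialUnitaryGroup n ℂ) : Matrix n n ℂ)) :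
    ∀ (w : List (Letter P.d)) (x : Site P k),
      ((holT (W a) x w : (Matrix n n ℂ)ˣ) : Matrix n n ℂ) = ((holAt V₀ (walk x w) : Matrix.specialUnitaryGroup n ℂ) : Matrix n n ℂ)
  | [], x => by simp [holT_nil, walk, holAt_nil]
  | (μ, true) :: w, x => by
    rw [holT_cons_true, Units.val_mul, coe_holT_eq_coe_holAt hWa w (x.shift μ), hWa]
    simp [walk, holAt_cons]
  | (μ, false) :: w, x => by
    rw [holT_cons_false, Units.val_mul, coe_holT_eq_coe_holAt hWa w (x.unshift μ), coe_units_inv_eq_star (hWa _)]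
    simp only [walk, holAt_cons, Bool.false_eq_true, ↓reduceIte, Submonoid.coe_mul]
    rfl

omit [NormedAddCommGroup E] [NormedSpace ℂ E] in
/-- … and `↑(holT (W a) x w)⁻¹ = (↑(holAt V₀ (walk x w)))*`. [cite: Balaban1985Averaging, (9) p.18] -/
theorem coe_holT_inv_eq_star_holAt (hWa : ∀ b : PBond P k, ((W a b : (Matrix n n ℂ)ˣ) : Matrix n n ℂ) = ((V₀ b : Matrix.specialUnitaryGroup n ℂ) : Matrix n n ℂ))
    (w : List (Letter P.d)) (x : Site P k) :
    (((holT (W a) x w)⁻¹ : (Matrix n n ℂ)ˣ) : Matrix n n ℂ) = star ((holAt V₀ (walk x w) : Matrix.specialUnitaryGroup n ℂ) : Matrix n n ℂ) :=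
  coe_units_inv_eq_star (coe_holT_eq_coe_holAt V₀ W hWa w x)

/-! ## §3 ★★★ The stair-ratio derivative is the transported sum of the link derivatives -/

/-- ★★ **`D[W(Γ)·V₀(Γ)*](a) = Y_{V₀}(Γ)` WITH `Y b = W′_b · V₀(b)*`** — for every word `w` from every site `x`: the ℂ-derivative at `a` of `A ↦ ↑(holT (W A) x w)·(↑(holAt V₀ (walk x w)))*`
EXISTS and its value at `v` is lit's covariant walk sum `covWalkSum V₀ (b ↦ W′ b v · (↑(V₀ b))*) (walk x w)` ((58): forward step `Y_b`, backward step `−V₀(b)*·Y_b·V₀(b)`, later steps transported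
by the background holonomy of the earlier ones). [cite: Balaban1985Averaging, (56)–(58) p.27, (9) p.18] -/
theorem exists_hasFDerivAt_holT_mul_star_holAt
    (hWa : ∀ b : PBond P k, ((W a b : (Matrix n n ℂ)ˣ) : Matrix n n ℂ) = ((V₀ b : Matrix.specialUnitaryGroup n ℂ) : Matrix n n ℂ))
    {W' : PBond P k → E →L[ℂ] Matrix n n ℂ} (hW' : ∀ b : PBond P k, HasFDerivAt (fun A => ((W A b : (Matrix n n ℂ)ˣ) : Matrix n n ℂ)) (W' b) a) :
    ∀ (w : List (Letter P.d)) (x : Site P k), ∃ D : E →L[ℂ] Matrix n n ℂ,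
      HasFDerivAt (fun A => ((holT (W A) x w : (Matrix n n ℂ)ˣ) : Matrix n n ℂ) * star ((holAt V₀ (walk x w) : Matrix.specialUnitaryGroup n ℂ) : Matrix n n ℂ)) D a ∧
        ∀ v : E, D v = covWalkSum V₀ (fun b => W' b v * star ((V₀ b : Matrix.specialUnitaryGroup n ℂ) : Matrix n n ℂ)) (walk x w)
  | [], x => by
    refine ⟨0, ?_, fun v => by simp [walk]⟩
    have h : (fun A => ((holT (W A) x [] : (Matrix n n ℂ)ˣ) : Matrix n n ℂ) * star ((holAt V₀ (walk x []) : Matrix.specialUnitaryGroup n ℂ) : Matrix n n ℂ))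
        = fun _ => 1 := by
      funext A; simp [holT_nil, walk, holAt_nil]
    rw [h]; exact hasFDerivAt_const _ _
  | (μ, true) :: w, x => by
    obtain ⟨D, hD, hDv⟩ := exists_hasFDerivAt_holT_mul_star_holAt hWa hW' w (x.shift μ)
    -- the inner ratio is `1` at the base point
    have hin : ((holT (W a) (x.shift μ) w : (Matrix n n ℂ)ˣ) : Matrix n n ℂ) * star ((holAt V₀ (walk (x.shift μ) w) : Matrix.specialUnitaryGroup n ℂ) : Matrix n n ℂ) = 1 := by
      rw [coe_holT_eq_coe_holAt V₀ W hWa, coe_mul_star_self]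
    have heq : (fun A => ((holT (W A) x ((μ, true) :: w) : (Matrix n n ℂ)ˣ) : Matrix n n ℂ) * star ((holAt V₀ (walk x ((μ, true) :: w)) : Matrix.specialUnitaryGroup n ℂ) : Matrix n n ℂ))
        = fun A => ((W A ⟨x, μ⟩ : (Matrix n n ℂ)ˣ) : Matrix n n ℂ)
            * (((holT (W A) (x.shift μ) w : (Matrix n n ℂ)ˣ) : Matrix n n ℂ) * star ((holAt V₀ (walk (x.shift μ) w) : Matrix.specialUnitaryGroup n ℂ) : Matrix n n ℂ))
            * star ((V₀ ⟨x, μ⟩ : Matrix.specialUnitaryGroup n ℂ) : Matrix n n ℂ) := by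
      funext A
      simp only [holT_cons_true, Units.val_mul, walk, holAt_cons, ↓reduceIte, Submonoid.coe_mul, star_mul]
      noncomm_ring
    rw [heq]
    have hprod := ((hW' ⟨x, μ⟩).mul' hD).mul' (hasFDerivAt_const (star ((V₀ ⟨x, μ⟩ : Matrix.specialUnitaryGroup n ℂ) : Matrix n n ℂ)) a)
    refine ⟨_, hprod, fun v => ?_⟩
    simp only [walk, covWalkSum_cons, covStep, stepFactor, ↓reduceIte]
    simp [hin, hWa, hDv v, add_comm]
  | (μ, false) :: w, x => by
    obtain ⟨D, hD, hDv⟩ := exists_hasFDerivAt_holT_mul_star_holAt hWa hW' w (x.unshift μ)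
    have hin : ((holT (W a) (x.unshift μ) w : (Matrix n n ℂ)ˣ) : Matrix n n ℂ) * star ((holAt V₀ (walk (x.unshift μ) w) : Matrix.specialUnitaryGroup n ℂ) : Matrix n n ℂ) = 1 := by
      rw [coe_holT_eq_coe_holAt V₀ W hWa, coe_mul_star_self]
    have hinv0 : (((W a ⟨x.unshift μ, μ⟩)⁻¹ : (Matrix n n ℂ)ˣ) : Matrix n n ℂ) = star ((V₀ ⟨x.unshift μ, μ⟩ : Matrix.specialUnitaryGroup n ℂ) : Matrix n n ℂ) :=
      coe_units_inv_eq_star (hWa _)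
    have heq : (fun A => ((holT (W A) x ((μ, false) :: w) : (Matrix n n ℂ)ˣ) : Matrix n n ℂ) * star ((holAt V₀ (walk x ((μ, false) :: w)) : Matrix.specialUnitaryGroup n ℂ) : Matrix n n ℂ))
        = fun A => (((W A ⟨x.unshift μ, μ⟩)⁻¹ : (Matrix n n ℂ)ˣ) : Matrix n n ℂ)
            * (((holT (W A) (x.unshift μ) w : (Matrix n n ℂ)ˣ) : Matrix n n ℂ) * star ((holAt V₀ (walk (x.unshift μ) w) : Matrix.specialUnitaryGroup n ℂ) : Matrix n n ℂ))
            * ((V₀ ⟨x.unshift μ, μ⟩ : Matrix.specialUnitaryGroup n ℂ) : Matrix n n ℂ) := by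
      funext A
      simp only [holT_cons_false, Units.val_mul, walk, holAt_cons, Bool.false_eq_true, ↓reduceIte, Submonoid.coe_mul, star_mul]
      rw [show (((V₀ ⟨x.unshift μ, μ⟩)⁻¹ : Matrix.specialUnitaryGroup n ℂ) : Matrix n n ℂ) = star ((V₀ ⟨x.unshift μ, μ⟩ : Matrix.specialUnitaryGroup n ℂ) : Matrix n n ℂ) from rfl,
        star_star]
      noncomm_ring
    rw [heq]
    have hprod := (((hasFDerivAt_coe_units_inv (hW' ⟨x.unshift μ, μ⟩)).mul' hD).mul'
      (hasFDerivAt_const (((V₀ ⟨x.unshift μ, μ⟩ : Matrix.specialUnitaryGroup n ℂ) : Matrix n n ℂ)) a))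
    refine ⟨_, hprod, fun v => ?_⟩
    have hss : star ((V₀ ⟨x.unshift μ, μ⟩ : Matrix.specialUnitaryGroup n ℂ) : Matrix n n ℂ) * ((V₀ ⟨x.unshift μ, μ⟩ : Matrix.specialUnitaryGroup n ℂ) : Matrix n n ℂ) = 1 :=
      coe_star_mul_self _
    simp only [walk, covWalkSum_cons, covStep, stepFactor, Bool.false_eq_true, ↓reduceIte]
    simp [ContinuousLinearMap.mulLeftRight_apply, hin, hinv0, hDv v, hss, mul_assoc, add_comm]

/-- `A ↦ ↑(holT (W A) x w)·(↑(holAt V₀ (walk x w)))*` is differentiable at the base point. [cite: Balaban1985Averaging, (58) p.27] -/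
theorem differentiableAt_holT_mul_star_holAt
    (hWa : ∀ b : PBond P k, ((W a b : (Matrix n n ℂ)ˣ) : Matrix n n ℂ) = ((V₀ b : Matrix.specialUnitaryGroup n ℂ) : Matrix n n ℂ))
    (hW : ∀ b : PBond P k, DifferentiableAt ℂ (fun A => ((W A b : (Matrix n n ℂ)ˣ) : Matrix n n ℂ)) a) (w : List (Letter P.d)) (x : Site P k) :
    DifferentiableAt ℂ (fun A => ((holT (W A) x w : (Matrix n n ℂ)ˣ) : Matrix n n ℂ) * star ((holAt V₀ (walk x w) : Matrix.specialUnitaryGroup n ℂ) : Matrix n n ℂ)) a := by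
  obtain ⟨D, hD, -⟩ := exists_hasFDerivAt_holT_mul_star_holAt V₀ W hWa (fun b => (hW b).hasFDerivAt) w x
  exact hD.differentiableAt

/-- ★★★ **APPLIED FORM — THE STAIR-RATIO LINEAR PART IS `covWalkSum` OF THE LINK LINEAR PARTS**: under bondwise differentiability at the base point,
`fderiv ℂ (A ↦ ↑(holT (W A) x w)·(↑(holAt V₀ (walk x w)))*) a v = covWalkSum V₀ (b ↦ fderiv ℂ (A ↦ ↑(W A b)) a v · (↑(V₀ b))*) (walk x w)` — F-β's `covWalkSum V₀ ℓY Γ` with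
`ℓY b := fderiv ℂ (A ↦ ↑(W A b)) a v · (↑(V₀ b))*` TOKEN FOR TOKEN. [cite: Balaban1985Averaging, (56)–(58) p.27] -/
theorem fderiv_holT_mul_star_holAt_apply
    (hWa : ∀ b : PBond P k, ((W a b : (Matrix n n ℂ)ˣ) : Matrix n n ℂ) = ((V₀ b : Matrix.specialUnitaryGroup n ℂ) : Matrix n n ℂ))
    (hW : ∀ b : PBond P k, DifferentiableAt ℂ (fun A => ((W A b : (Matrix n n ℂ)ˣ) : Matrix n n ℂ)) a) (w : List (Letter P.d)) (x : Site P k) (v : E) :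
    fderiv ℂ (fun A => ((holT (W A) x w : (Matrix n n ℂ)ˣ) : Matrix n n ℂ) * star ((holAt V₀ (walk x w) : Matrix.specialUnitaryGroup n ℂ) : Matrix n n ℂ)) a v
      = covWalkSum V₀ (fun b => fderiv ℂ (fun A => ((W A b : (Matrix n n ℂ)ˣ) : Matrix n n ℂ)) a v * star ((V₀ b : Matrix.specialUnitaryGroup n ℂ) : Matrix n n ℂ)) (walk x w) := by
  obtain ⟨D, hD, hDv⟩ := exists_hasFDerivAt_holT_mul_star_holAt V₀ W hWa (fun b => (hW b).hasFDerivAt) w x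
  rw [hD.fderiv, hDv]

omit [NormedAddCommGroup E] [NormedSpace ℂ E] in
/-- **THE UNITS-RATIO SPELLING** (✓R0-LIN-S's stair-ratio letter `R_{k,i}(t) = holT (W t) x w · (holT (W a) x w)⁻¹`): as functions of `A`,
`↑(holT (W A) x w · (holT (W a) x w)⁻¹) = ↑(holT (W A) x w)·(↑(holAt V₀ (walk x w)))*` (§2). [cite: Balaban1985Averaging, (58) p.27] -/
theorem coe_holT_ratio_eq
    (hWa : ∀ b : PBond P k, ((W a b : (Matrix n n ℂ)ˣ) : Matrix n n ℂ) = ((V₀ b : Matrix.specialUnitaryGroup n ℂ) : Matrix n n ℂ)) (w : List (Letter P.d)) (x : Site P k) :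
    (fun A => ((holT (W A) x w * (holT (W a) x w)⁻¹ : (Matrix n n ℂ)ˣ) : Matrix n n ℂ))
      = fun A => ((holT (W A) x w : (Matrix n n ℂ)ˣ) : Matrix n n ℂ) * star ((holAt V₀ (walk x w) : Matrix.specialUnitaryGroup n ℂ) : Matrix n n ℂ) := by
  funext A
  rw [Units.val_mul, coe_holT_inv_eq_star_holAt V₀ W hWa]

/-- ★★★ **THE STAIR-RATIO DERIVATIVE, UNITS SPELLING** (px13 g6's F-γ letter): under bondwise differentiability at the base point,
`fderiv ℂ (A ↦ ↑(holT (W A) x w · (holT (W a) x w)⁻¹)) a v = covWalkSum V₀ (b ↦ fderiv ℂ (A ↦ ↑(W A b)) a v · (↑(V₀ b))*) (walk x w)`, and the ratio is differentiable there —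
so ✓R0-LIN-S `fderiv_coe_frameAccU_succ_apply`'s `ℓR y i` IS F-β's `covWalkSum V₀ ℓY (walk (emb y) st_i)` at `x := emb y`, `w := stairWord i.2.1 (off i.1)`.
[cite: Balaban1985Averaging, (56)–(58) p.27, (82) p.30] -/
theorem fderiv_holT_ratio_apply
    (hWa : ∀ b : PBond P k, ((W a b : (Matrix n n ℂ)ˣ) : Matrix n n ℂ) = ((V₀ b : Matrix.specialUnitaryGroup n ℂ) : Matrix n n ℂ))
    (hW : ∀ b : PBond P k, DifferentiableAt ℂ (fun A => ((W A b : (Matrix n n ℂ)ˣ) : Matrix n n ℂ)) a) (w : List (Letter P.d)) (x : Site P k) (v : E) :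
    DifferentiableAt ℂ (fun A => ((holT (W A) x w * (holT (W a) x w)⁻¹ : (Matrix n n ℂ)ˣ) : Matrix n n ℂ)) a ∧
    fderiv ℂ (fun A => ((holT (W A) x w * (holT (W a) x w)⁻¹ : (Matrix n n ℂ)ˣ) : Matrix n n ℂ)) a v
      = covWalkSum V₀ (fun b => fderiv ℂ (fun A => ((W A b : (Matrix n n ℂ)ˣ) : Matrix n n ℂ)) a v * star ((V₀ b : Matrix.specialUnitaryGroup n ℂ) : Matrix n n ℂ)) (walk x w) := by
  rw [coe_holT_ratio_eq V₀ W hWa w x]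
  exact ⟨differentiableAt_holT_mul_star_holAt V₀ W hWa hW w x, fderiv_holT_mul_star_holAt_apply V₀ W hWa hW w x v⟩

/-- `HasFDerivAt` transfer for the units spelling (any candidate derivative). [cite: Balaban1985Averaging, (58) p.27] -/
theorem hasFDerivAt_holT_ratio_iff
    (hWa : ∀ b : PBond P k, ((W a b : (Matrix n n ℂ)ˣ) : Matrix n n ℂ) = ((V₀ b : Matrix.specialUnitaryGroup n ℂ) : Matrix n n ℂ)) (w : List (Letter P.d)) (x : Site P k)
    (D : E →L[ℂ] Matrix n n ℂ) :
    HasFDerivAt (fun A => ((holT (W A) x w * (holT (W a) x w)⁻¹ : (Matrix n n ℂ)ˣ) : Matrix n n ℂ)) D a ↔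
      HasFDerivAt (fun A => ((holT (W A) x w : (Matrix n n ℂ)ˣ) : Matrix n n ℂ) * star ((holAt V₀ (walk x w) : Matrix.specialUnitaryGroup n ℂ) : Matrix n n ℂ)) D a := by
  rw [coe_holT_ratio_eq V₀ W hWa w x]

/-! ## §4 The link letter -/

omit [Nonempty n] in
/-- **THE LINK LINEAR PART** (`pertVar`'s shape `U_b·U₀,b* − 1`, ✓`Prop7TwistedTowerFramesT3.coe_unitsField_mul_inv_sub_one`): under differentiability of the bond value,
`fderiv ℂ (A ↦ ↑(W A b)·(↑(V₀ b))* − 1) a v = fderiv ℂ (A ↦ ↑(W A b)) a v · (↑(V₀ b))*`. [cite: Balaban1985Variational, (15) p.280] -/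
theorem fderiv_link_apply (hW : ∀ b : PBond P k, DifferentiableAt ℂ (fun A => ((W A b : (Matrix n n ℂ)ˣ) : Matrix n n ℂ)) a) (b : PBond P k) (v : E) :
    fderiv ℂ (fun A => ((W A b : (Matrix n n ℂ)ˣ) : Matrix n n ℂ) * star ((V₀ b : Matrix.specialUnitaryGroup n ℂ) : Matrix n n ℂ) - 1) a v
      = fderiv ℂ (fun A => ((W A b : (Matrix n n ℂ)ˣ) : Matrix n n ℂ)) a v * star ((V₀ b : Matrix.specialUnitaryGroup n ℂ) : Matrix n n ℂ) := by
  have h := ((hW b).hasFDerivAt.mul_const' (star ((V₀ b : Matrix.specialUnitaryGroup n ℂ) : Matrix n n ℂ))).sub_const (1 : Matrix n n ℂ)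
  rw [h.fderiv]
  simp

omit [Nonempty n] [NormedAddCommGroup E] [NormedSpace ℂ E] in
/-- the units-inverse spelling of the link letter: `↑(W A b · (W a b)⁻¹) − 1 = ↑(W A b)·(↑(V₀ b))* − 1` as functions of `A`. [cite: Balaban1985Variational, (15) p.280] -/
theorem coe_link_ratio_eq
    (hWa : ∀ b : PBond P k, ((W a b : (Matrix n n ℂ)ˣ) : Matrix n n ℂ) = ((V₀ b : Matrix.specialUnitaryGroup n ℂ) : Matrix n n ℂ)) (b : PBond P k) :
    (fun A => ((W A b * (W a b)⁻¹ : (Matrix n n ℂ)ˣ) : Matrix n n ℂ) - 1)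
      = fun A => ((W A b : (Matrix n n ℂ)ˣ) : Matrix n n ℂ) * star ((V₀ b : Matrix.specialUnitaryGroup n ℂ) : Matrix n n ℂ) - 1 := by
  funext A
  rw [Units.val_mul, coe_units_inv_eq_star (hWa b)]

end Summit.QuantumFields.YangMills.Theorems.Prop7HolRatioLinearResponse

end
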